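/-
Copyright (c) 2026 the pub-hodgecm-mathlib formalisation cell (harness21).  Prover seat hodgecm-mathlib-K2Liu-p12 (g0): Track B «K2-LIT»,
#184♮ = hLiu418 = stmt-HodgeConjecture-24832; Road Φ of socket #41, organ Φ4 «unramified local coefficient» (LEAD F0P6-plan (g13) ruling «M-157k»), file U3.
-/
import Summits.HodgeConjecture.HodgeConjecture.Theorems.K2LiuSkewLatticeShells           -- ★ F3b (K2Liu-p08): balls of `S` (open, compact, measurable)
import Literature.NumberTheory.GaloisRepresentations.LocalFieldModulus                    -- ★ `measure_smul_set_of_ne_zero` (`μ(a•s) = mod(a) μ(s)`)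
import Literature.NumberTheory.Automorphic.TateLocalZetaShells                           -- ★ `modulus_eq_normAbs`
import Literature.NumberTheory.Automorphic.AdicCompletionLocalField                      -- ★ `E_w` is a non-archimedean local field
import Mathlib.MeasureTheory.Measure.Haar.Unique
import HarnessLib

/-!
# Crux `HLiu418`, Road Φ of socket #41, organ Φ4 — FILE U3: BALL-VOLUME GROWTH IN THE SKEW LATTICE, `μ(B(a−1)) ≤ N_v · μ(B(a))`

Cell `hodgecm-mathlib`, crux item hLiu418 = `stmt-HodgeConjecture-24832`, route of record `HCCMUnconditional`; squad K2 ∕ K2Liu, road `K2_Liu`,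
socket #41 `sig_K2LiuSiegelEisensteinContinuation`, Road Φ, organ Φ4 = «(R-bound) + the one exact value» (ruling M-157k; census
`K2/K2Liu-p12/g0/CENSUS-PHI4-UnramifiedLocalCoefficient.K2Liu-p12-g0.md` §1 (U3)).  THEOREMS ONLY (no `def`, no `instance`, no `notation`, no
named-fact hypothesis, no `sorry`); lane `--supports stmt-HodgeConjecture-24832` (count-neutral helper; closes no socket by itself).

WHAT.  `S` = the skew lattice carrier of ★ F3b (`T`-skew matrices over `E ⊗ F_v = Π_{w∣v} E_w`), `μ` an additive Haar measure on `S`, and the balls of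
record `B(a) = {t ∈ S : v_w(t_{ijw}) ≤ v_w(ϖ_w)^a ∀ i j w}` (`ϖ_w = ι_w(π)`).  Then for every `a`
  **`μ(B(a−1)) ≤ N_v · μ(B(a))`,   `N_v = ∏_{(i,j,w)} |ι_w(π)|_w⁻¹ = (∏_{w∣v} |π|_w⁻¹)^{n²}`,**
hence `μ(B(−K)) ≤ N_v^K · μ(B(0))` (`K ∈ ℕ`) — the volume letter of the (R-bound) face (★ `K2LiuGoodPlaceWhittakerBound.goodPlace_whittaker_norm_le`).
For the CM datum `∏_{w∣v} |π|_w = |π|_v²` (★ `normAbs_toPlace_eq_sq` at a non-split `v`, ★ `normAbs_toPlace_of_split` twice at a split one), so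
`N_v = q_v^{2n²}`: POLYNOMIAL in `q_v`, uniformly in `v`.
HOW (no Smith form, no module theory).  (G1) for additive subgroups `H ≤ K` of a locally compact abelian group, `[K:H]·μ(H) = μ(K)` (Haar measure pulled
back to `K`, Mathlib `AddSubgroup.index_mul_measure`); (G2) `[K:H] < ∞` for `H` open, `K` compact (Mathlib `AddSubgroup.quotient_finite_of_isOpen`);
(G3) `[B(a−1):B(a)] ≤ ∏_{(i,j,w)} [ball_w(a−1) : ball_w(a)]` — the balls are intersections of coordinate pull-backs (Mathlib `AddSubgroup.relIndex_iInf_le`,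
`relIndex_comap`, `relIndex_le_of_le_right`); (G4) in `E_w`, `[ball_w(a−1) : ball_w(a)] = |ϖ_w|_w⁻¹` by (G1) and `μ_w(ϖ_w • X) = |ϖ_w|_w μ_w(X)`
(★ `measure_smul_set_of_ne_zero`, ★ `modulus_eq_normAbs`).

## References
* [WeilBNT1967] A. Weil, Basic Number Theory (1967), Ch. I §2, Ch. II §4.   * [BushnellHenniart2006] C. Bushnell, G. Henniart, GL(2) local Langlands (2006), §1.1.
* [Shimura1997] G. Shimura, CBMS 93 (1997), §13.
-/

set_option autoImplicit false
-- the mandated namespace repeats the single-problem summit's segment (`HodgeConjecture.HodgeConjecture`)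
set_option linter.dupNamespace false

noncomputable section

open scoped NNReal ENNReal Topology Pointwise
open NumberField IsDedekindDomain Matrix MeasureTheory Set
open Literature.NumberTheory.GaloisRepresentations Literature.NumberTheory.GaloisRepresentations.IsNonarchimedeanLocalField
open Literature.NumberTheory.Automorphic Literature.NumberTheory.Automorphic.UnitaryGroup
open Literature.NumberTheory.GelbartRogawski1991.UnitaryDualPair.LocalSplitting
open Summit.HodgeConjecture.HodgeConjecture.Cruxes.HLiu418.K2LiuLocalRingValuationBalls
open Summit.HodgeConjecture.HodgeConjecture.Cruxes.HLiu418.K2LiuSkewLatticeShells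

namespace Summit.HodgeConjecture.HodgeConjecture.Cruxes.HLiu418.K2LiuSkewBallVolumeGrowth

/-! ## §1 (G1)–(G2): index times measure, finiteness of the index -/

section Generic

variable {V : Type*} [AddCommGroup V] [TopologicalSpace V] [IsTopologicalAddGroup V] [MeasurableSpace V] [BorelSpace V]

/-- **`[K : H] · μ(H) = μ(K)`** for additive subgroups `H ≤ K` (both measurable) of finite relative index and a left-invariant measure `μ`
(the `[K:H]` cosets of `H` in `K` are translates of `H`; Mathlib `AddSubgroup.index_mul_measure` on the group `K` with the pulled-back measure).
[cite: WeilBNT1967, Ch. I §2] -/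
theorem relIndex_mul_measure (μ : Measure V) [μ.IsAddLeftInvariant] {H K : AddSubgroup V} (hHK : H ≤ K)
    (hHm : MeasurableSet (H : Set V)) (hKm : MeasurableSet (K : Set V)) (hfin : H.relIndex K ≠ 0) :
    (H.relIndex K : ℝ≥0∞) * μ H = μ K := by
  have hι : MeasurableEmbedding (K.subtype : K → V) := MeasurableEmbedding.subtype_coe hKm
  haveI : (μ.comap K.subtype).IsAddLeftInvariant := Measure.IsAddLeftInvariant.comap μ (f := K.subtype) hι
  haveI : (H.addSubgroupOf K).FiniteIndex := ⟨hfin⟩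
  have hH'm : MeasurableSet ((H.addSubgroupOf K : AddSubgroup K) : Set K) := measurable_subtype_coe hHm
  have h := AddSubgroup.index_mul_measure (H.addSubgroupOf K) hH'm (μ.comap K.subtype)
  rw [hι.comap_apply, hι.comap_apply, Set.image_univ] at h
  have h1 : (K.subtype : K → V) '' ((H.addSubgroupOf K : AddSubgroup K) : Set K) = (H : Set V) := by
    ext x
    constructor
    · rintro ⟨y, hy, rfl⟩; exact hy
    · intro hx; exact ⟨⟨x, hHK hx⟩, hx, rfl⟩
  have h2 : Set.range (K.subtype : K → V) = (K : Set V) := by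
    change Set.range ((↑) : K → V) = _
    exact Subtype.range_coe
  rw [h1, h2] at h
  exact h

omit [MeasurableSpace V] [BorelSpace V] in
/-- **`[K : H] ≠ 0`** (finite relative index) for `H` open and `K` compact: `K ∕ (H ∩ K)` is compact and discrete.
[cite: BushnellHenniart2006, §1.1] -/
theorem relIndex_ne_zero_of_isOpen_of_isCompact {H K : AddSubgroup V} (hH : IsOpen (H : Set V)) (hK : IsCompact (K : Set V)) :
    H.relIndex K ≠ 0 := by
  haveI : CompactSpace K := isCompact_iff_compactSpace.1 hK
  have hopen : IsOpen ((H.addSubgroupOf K : AddSubgroup K) : Set K) := continuous_subtype_val.isOpen_preimage _ hH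
  haveI := AddSubgroup.quotient_finite_of_isOpen (H.addSubgroupOf K) hopen
  exact AddSubgroup.index_ne_zero_of_finite

/-- **`μ(K) ≤ [K : H] · μ(H)`** — (G1) read as an inequality (finite relative index). [cite: WeilBNT1967, Ch. I §2] -/
theorem measure_le_relIndex_mul (μ : Measure V) [μ.IsAddLeftInvariant] {H K : AddSubgroup V} (hHK : H ≤ K)
    (hHm : MeasurableSet (H : Set V)) (hKm : MeasurableSet (K : Set V)) (hfin : H.relIndex K ≠ 0) :
    μ K ≤ (H.relIndex K : ℝ≥0∞) * μ H :=
  (relIndex_mul_measure μ hHK hHm hKm hfin).ge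

end Generic

/-! ## §2 (G4): the one-dimensional index `[ball_w(a−1) : ball_w(a)] = |ϖ_w|_w⁻¹` -/

section OneDim

variable (F : Type) [Field F] [NumberField F] (E : Type) [Field E] [NumberField E] [Algebra F E]
  (v : HeightOneSpectrum (𝓞 F)) {π : v.adicCompletion F} (hπ : Valued.v π = WithZero.exp (-1 : ℤ))

include hπ in
/-- **`[ball_w(a−1) : ball_w(a)] · |ϖ_w|_w = 1`** in `E_w`, where `ball_w(a) = {x : v_w(x) ≤ v_w(ϖ_w)^a}` (as Mathlib `Valuation.leAddSubgroup`s) and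
`ϖ_w = ι_w(π)`: `ball_w(a) = ϖ_w • ball_w(a−1)`, `μ_w(ϖ_w • X) = |ϖ_w|_w μ_w(X)`, and (G1). [cite: WeilBNT1967, Ch. I §2, Ch. II §4] -/
theorem relIndex_leBall_mul_normAbs (a : ℤ) (w : PlacesOver E v) :
    ((((Valued.v : Valuation (w.1.adicCompletion E) (WithZero (Multiplicative ℤ))).leAddSubgroup (Valued.v (toPlace v w π) ^ a)).relIndex
          ((Valued.v : Valuation (w.1.adicCompletion E) (WithZero (Multiplicative ℤ))).leAddSubgroup (Valued.v (toPlace v w π) ^ (a - 1))) : ℝ≥0∞) *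
        (normAbs (w.1.adicCompletion E) (toPlace v w π) : ℝ≥0∞)) = 1 := by
  set Ew := w.1.adicCompletion E
  set ϖ : Ew := toPlace v w π with hϖ
  have hϖ0 : ϖ ≠ 0 := (map_ne_zero_iff _ (toPlace v w).injective).2 (uniformizer_ne_zero F v hπ)
  set H : AddSubgroup Ew := (Valued.v : Valuation Ew (WithZero (Multiplicative ℤ))).leAddSubgroup (Valued.v ϖ ^ a) with hH
  set K : AddSubgroup Ew := (Valued.v : Valuation Ew (WithZero (Multiplicative ℤ))).leAddSubgroup (Valued.v ϖ ^ (a - 1)) with hK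
  have hHset : (H : Set Ew) = {x : Ew | Valued.v x ≤ Valued.v (toPlace v w π) ^ a} := rfl
  have hKset : (K : Set Ew) = {x : Ew | Valued.v x ≤ Valued.v (toPlace v w π) ^ (a - 1)} := rfl
  have hHK : H ≤ K := fun x hx => by
    rw [Valuation.mem_leAddSubgroup_iff] at hx ⊢
    exact hx.trans (zpow_le_zpow_right_of_le_one₀ (zero_lt_iff.2 (valued_toPlace_uniformizer_ne_zero F E v hπ w))
      (valued_toPlace_uniformizer_le_one F E v hπ w) (by omega))
  borelize Ew
  set μw : Measure Ew := Measure.addHaar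
  have hHo : IsOpen (H : Set Ew) := by rw [hHset]; exact isOpen_setOf_valued_le F E v hπ a w
  have hKc : IsCompact (K : Set Ew) := by rw [hKset]; exact isCompact_setOf_valued_le F E v hπ (a - 1) w
  have hfin := relIndex_ne_zero_of_isOpen_of_isCompact hHo hKc
  have hG1 := relIndex_mul_measure μw hHK hHo.measurableSet hKc.isClosed.measurableSet hfin
  -- `H = ϖ • K`
  have hsmul : (H : Set Ew) = ϖ • (K : Set Ew) := by
    have h0 : Valued.v ϖ ≠ 0 := (Valuation.ne_zero_iff _).2 hϖ0
    ext x
    rw [Set.mem_smul_set_iff_inv_smul_mem₀ hϖ0, SetLike.mem_coe, SetLike.mem_coe, Valuation.mem_leAddSubgroup_iff, Valuation.mem_leAddSubgroup_iff,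
      smul_eq_mul, map_mul, map_inv₀, zpow_sub_one₀ h0, mul_comm (Valued.v ϖ ^ a)]
    constructor
    · intro h; exact mul_le_mul' le_rfl h
    · intro h
      have h' := mul_le_mul' (le_refl (Valued.v ϖ)) h
      rwa [mul_inv_cancel_left₀ h0, mul_inv_cancel_left₀ h0] at h'
  have hmod : μw H = (normAbs Ew ϖ : ℝ≥0∞) * μw K := by
    rw [hsmul, measure_smul_set_of_ne_zero μw hϖ0, modulus_eq_normAbs]
  -- `μw K ∈ (0, ∞)`
  have hK0 : μw K ≠ 0 := (IsOpen.measure_pos μw (by rw [hKset]; exact isOpen_setOf_valued_le F E v hπ (a - 1) w) ⟨0, K.zero_mem⟩).ne'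
  have hKtop : μw K ≠ ∞ := hKc.measure_lt_top.ne
  rw [hmod, ← mul_assoc] at hG1
  exact (ENNReal.mul_eq_right hK0 hKtop).1 hG1 |> fun h => by rw [h]

end OneDim

/-! ## §3 (G3) and the growth bound in the skew lattice -/

section Skew

variable (F : Type) [Field F] [NumberField F] (E : Type) [Field E] [NumberField E] [Algebra F E] (c : E ≃ₐ[F] E)
  (v : HeightOneSpectrum (𝓞 F)) {π : v.adicCompletion F} (hπ : Valued.v π = WithZero.exp (-1 : ℤ))
  (n : ℕ) {T₀ : Matrix (Fin n) (Fin n) F}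
  (S : AddSubgroup (Matrix (Fin n) (Fin n) (LocalRing E v)))
  (hS : ∀ t, t ∈ S ↔ (t.map (conjLocal E c v))ᵀ * gramS F E v n T₀ + gramS F E v n T₀ * t = 0)

include c hS hπ in
/-- **BALL-VOLUME GROWTH, INDEX FORM**: `μ(B(a−1)) ≤ (∏_{(i,j,w)} [ball_w(a−1) : ball_w(a)]) · μ(B(a))` — the balls of `S` are the intersections of the
coordinate pull-backs of the `ball_w`, so `[B(a−1):B(a)]` divides into the product of the coordinate indices (Mathlib `AddSubgroup.relIndex_iInf_le`,
`relIndex_comap`), and `μ(B(a−1)) = [B(a−1):B(a)]·μ(B(a))` (G1). [cite: WeilBNT1967, Ch. II §4] [cite: BushnellHenniart2006, §1.1] -/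
theorem measure_ball_le_prod_relIndex_mul [MeasurableSpace S] [BorelSpace S] (μ : Measure S) [μ.IsAddHaarMeasure] (a : ℤ) :
    μ {t : S | ∀ i j (w : PlacesOver E v), Valued.v (t.1 i j w) ≤ Valued.v (toPlace v w π) ^ (a - 1)} ≤
      (∏ p : Fin n × Fin n × PlacesOver E v,
          (((Valued.v : Valuation (p.2.2.1.adicCompletion E) (WithZero (Multiplicative ℤ))).leAddSubgroup (Valued.v (toPlace v p.2.2 π) ^ a)).relIndex
            ((Valued.v : Valuation (p.2.2.1.adicCompletion E) (WithZero (Multiplicative ℤ))).leAddSubgroup (Valued.v (toPlace v p.2.2 π) ^ (a - 1))) : ℝ≥0∞)) *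
        μ {t : S | ∀ i j (w : PlacesOver E v), Valued.v (t.1 i j w) ≤ Valued.v (toPlace v w π) ^ a} := by
  classical
  -- the coordinate maps and the coordinate balls
  obtain ⟨ev, hev⟩ : ∃ ev : ∀ p : Fin n × Fin n × PlacesOver E v, S →+ p.2.2.1.adicCompletion E, ∀ p t, ev p t = t.1 p.1 p.2.1 p.2.2 :=
    ⟨fun p => { toFun := fun t => t.1 p.1 p.2.1 p.2.2, map_zero' := rfl, map_add' := fun _ _ => rfl }, fun _ _ => rfl⟩
  obtain ⟨L, hL⟩ : ∃ L : ∀ p : Fin n × Fin n × PlacesOver E v, ℤ → AddSubgroup (p.2.2.1.adicCompletion E), ∀ p b,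
      L p b = (Valued.v : Valuation (p.2.2.1.adicCompletion E) (WithZero (Multiplicative ℤ))).leAddSubgroup (Valued.v (toPlace v p.2.2 π) ^ b) :=
    ⟨_, fun _ _ => rfl⟩
  obtain ⟨BS, hBS⟩ : ∃ BS : ℤ → AddSubgroup S, ∀ b, BS b = ⨅ p, (L p b).comap (ev p) := ⟨_, fun _ => rfl⟩
  have hBSset : ∀ b : ℤ, (BS b : Set S) = {t : S | ∀ i j (w : PlacesOver E v), Valued.v (t.1 i j w) ≤ Valued.v (toPlace v w π) ^ b} := by
    intro b; ext t
    simp only [hBS, hL, SetLike.mem_coe, AddSubgroup.mem_iInf, AddSubgroup.mem_comap, hev, Valuation.mem_leAddSubgroup_iff, Set.mem_setOf_eq]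
    exact ⟨fun h i j w => h (i, j, w), fun h p => h p.1 p.2.1 p.2.2⟩
  have hle : BS a ≤ BS (a - 1) := by
    intro t ht
    have ht' : t ∈ (BS a : Set S) := ht
    rw [hBSset] at ht'
    have : t ∈ (BS (a - 1) : Set S) := by rw [hBSset]; exact ball_antitone F E v hπ n S (by omega) ht'
    exact this
  -- finiteness of the index and (G1)
  have hopen : IsOpen (BS a : Set S) := by rw [hBSset]; exact isOpen_ball F E v hπ n S a
  have hcpt : IsCompact (BS (a - 1) : Set S) := by rw [hBSset]; exact isCompact_ball F E c v hπ n S hS (a - 1)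
  have hfin := relIndex_ne_zero_of_isOpen_of_isCompact hopen hcpt
  have hG1 := relIndex_mul_measure μ hle hopen.measurableSet hcpt.isClosed.measurableSet hfin
  rw [hBSset, hBSset] at hG1
  rw [← hG1]
  refine mul_le_mul_left ?_ _
  -- (G3) the index bound
  have hidx : (BS a).relIndex (BS (a - 1)) ≤ ∏ p : Fin n × Fin n × PlacesOver E v, (L p a).relIndex (L p (a - 1)) := by
    rw [hBS a]
    refine (AddSubgroup.relIndex_iInf_le _).trans (Finset.prod_le_prod' fun p _ => ?_)
    rw [AddSubgroup.relIndex_comap]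
    refine AddSubgroup.relIndex_le_of_le_right ?_ ?_
    · rintro _ ⟨t, ht, rfl⟩
      have ht' : t ∈ (BS (a - 1) : Set S) := ht
      rw [hBSset] at ht'
      rw [hev, hL, Valuation.mem_leAddSubgroup_iff]
      exact ht' p.1 p.2.1 p.2.2
    · have ho : IsOpen (L p a : Set (p.2.2.1.adicCompletion E)) := by rw [hL]; exact isOpen_setOf_valued_le F E v hπ a p.2.2
      have hc : IsCompact (L p (a - 1) : Set (p.2.2.1.adicCompletion E)) := by rw [hL]; exact isCompact_setOf_valued_le F E v hπ (a - 1) p.2.2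
      exact relIndex_ne_zero_of_isOpen_of_isCompact ho hc
  have hcast : ((BS a).relIndex (BS (a - 1)) : ℝ≥0∞) ≤
      ((∏ p : Fin n × Fin n × PlacesOver E v, (L p a).relIndex (L p (a - 1)) : ℕ) : ℝ≥0∞) := by exact_mod_cast hidx
  refine hcast.trans (le_of_eq ?_)
  rw [Nat.cast_prod]
  exact Finset.prod_congr rfl fun p _ => by rw [hL, hL]

include c hS hπ in
/-- **BALL-VOLUME GROWTH**: `μ(B(a−1)) ≤ N_v · μ(B(a))` with `N_v = ∏_{(i,j,w)} |ι_w(π)|_w⁻¹` (the index form and (G4) `[ball_w(a−1):ball_w(a)] = |ι_w(π)|_w⁻¹`).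
[cite: WeilBNT1967, Ch. I §2, Ch. II §4] [cite: Shimura1997, §13] -/
theorem measure_ball_pred_le [MeasurableSpace S] [BorelSpace S] (μ : Measure S) [μ.IsAddHaarMeasure] (a : ℤ) :
    μ {t : S | ∀ i j (w : PlacesOver E v), Valued.v (t.1 i j w) ≤ Valued.v (toPlace v w π) ^ (a - 1)} ≤
      (∏ p : Fin n × Fin n × PlacesOver E v, ((normAbs (p.2.2.1.adicCompletion E) (toPlace v p.2.2 π) : ℝ≥0∞))⁻¹) *
        μ {t : S | ∀ i j (w : PlacesOver E v), Valued.v (t.1 i j w) ≤ Valued.v (toPlace v w π) ^ a} := by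
  refine (measure_ball_le_prod_relIndex_mul F E c v hπ n S hS μ a).trans (le_of_eq ?_)
  congr 1
  refine Finset.prod_congr rfl fun p _ => ?_
  exact ENNReal.eq_inv_of_mul_eq_one_left (relIndex_leBall_mul_normAbs F E v hπ a p.2.2)

include c hS hπ in
/-- **BALL-VOLUME GROWTH, ITERATED**: `μ(B(a − K)) ≤ N_v^K · μ(B(a))` for `K ∈ ℕ`; in particular `μ(B(−K)) ≤ N_v^K · μ(B(0))` — the volume letter of the
(R-bound) face of organ Φ4, polynomial in `q_v` (`N_v = q_v^{2n²}` for the CM datum). [cite: WeilBNT1967, Ch. II §4] [cite: Shimura1997, §13, §18] -/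
theorem measure_ball_sub_le_pow_mul [MeasurableSpace S] [BorelSpace S] (μ : Measure S) [μ.IsAddHaarMeasure] (a : ℤ) (K : ℕ) :
    μ {t : S | ∀ i j (w : PlacesOver E v), Valued.v (t.1 i j w) ≤ Valued.v (toPlace v w π) ^ (a - K)} ≤
      (∏ p : Fin n × Fin n × PlacesOver E v, ((normAbs (p.2.2.1.adicCompletion E) (toPlace v p.2.2 π) : ℝ≥0∞))⁻¹) ^ K *
        μ {t : S | ∀ i j (w : PlacesOver E v), Valued.v (t.1 i j w) ≤ Valued.v (toPlace v w π) ^ a} := by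
  induction K with
  | zero => simp
  | succ K ih =>
    have h := measure_ball_pred_le F E c v hπ n S hS μ (a - K)
    rw [show a - (K : ℤ) - 1 = a - ((K + 1 : ℕ) : ℤ) by push_cast; ring] at h
    refine h.trans ?_
    rw [pow_succ, mul_comm (_ ^ K), mul_assoc]
    exact mul_le_mul_right ih _

end Skew

end Summit.HodgeConjecture.HodgeConjecture.Cruxes.HLiu418.K2LiuSkewBallVolumeGrowth

end
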